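import Summits.BirchSwinnertonDyer.Rank1Residual.X2.NonsplitHalvesIntRigidity
import Summits.BirchSwinnertonDyer.Rank1Residual.X2.SplitHalvesOnTreeInt
import Literature.NumberTheory.EllipticCurves.Castella2018.AnticyclotomicSelmerDual
import HarnessLib

/-!
# Crux 4 `BSDpOnCellC` (stmt-BirchSwinnertonDyer-19034), line b1 (v7 `61c171a5`), stub `stub_c3`:
# `stub_c3` VERBATIM from the KELLER–YIN THEOREM-D CONCLUSION SHAPE *with the strict prime at the
# frame's prime* — and why the tree's Theorem-D binder (strict prime at the OTHER prime) cannot feed it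
# (cell `bsd-eis`, seat `bsd-eis-c3h` g2)

HONEST FRAMING (cell `bsd-eis`, run/shared/lean/pub/bsd-eis/): theorems only; nothing booked; X2 stays
CONSTRUCTION-SHAPED; no label or count moves; BSD is not proved by any of this. Every theorem below is
CONDITIONAL on a hypothesis-shaped premise stated INLINE on the binders of the registered stub (no new
`Prop`, no named fact): the CONCLUSION SHAPE of Keller–Yin, arXiv:2402.12781v2, Thm. D (= Thm. 5.1.3,
PREPRINT, gapped at L1754) — "`𝔛_f` is `Λ`-torsion and `Char(𝔛_f)Λ^nr = (𝓛_f)`" — read at the X2c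
Heegner data of the stub, WITH THE STRICT PRIME OF `X_ac` EQUAL TO THE PRIME `𝔭` OF THE FRAME. Nothing
here asserts that premise.

## What, and why this file exists (answer to seat g0's pointer (ii))

The tree carries TWO typings of "anticyclotomic IMC at a frame":
* family A (X11b route R1, X2 atoms c3♭/c3s♭ = `X2.NonsplitIMCEqOnTreeInt` / `X2.SplitIMCEqOnTreeInt`,
  `X2.HidaLimit*`): `Ch_Λ(X_ac^∅(E[p^∞]) STRICT AT 𝔭)·𝓞_{ℂ_p}⟦T⟧ = (Q)` for ♭-frames `Q` with
  `R1.IsBDPLFunctionInt p ι' 𝔭 …`, `𝔭` THE prime induced by the embedding datum `ι'`;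
* family B (Literature binders `KellerYin2024.thmD_imcMult_…_OPEN` (p455394),
  `CastellaGrossiLeeSkinner2022.proofThm422_…`, and `X1.KellerYinIMC2Halves`): `X_ac` STRICT AT `v̄` with a
  frame `IsBDPLFunction ι' v …` at `v`, `v` THE prime induced by `ι'`.
For one and the same frame predicate the two families name complex-CONJUGATE Selmer modules, whose
characteristic ideals differ by the involution `ι : γ ↦ γ⁻¹` of `Λ`; so at most one family is faithful to
print, and NO kernel bridge from the Theorem-D binder AS TYPED to `stub_c3` can exist (seat memo
`HOME/c3h-MEMO-1.md`: Castella–Hsieh 2018 Prop. 3.6 / §3.3, Burungale–Castella–Kim 2021 §2 + Thm. 4.1,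
CGLS 2022 §1.4 + Thm. 2.1.1, Keller–Yin §5.1 all pair the `𝔮`-adic BDP function with the Selmer group
RELAXED at `𝔮`, STRICT at `𝔮̄`; the tree's `IsBDPLFunction ι 𝔭` transcribes Castella 2018 Thm. 3.1's
display, which is the `𝔭̄`-adic interpolation shape; which tree family is the faithful one is decided by
the `Λ`-module convention on Pontryagin duals — memo §4).

This file records, in the kernel, exactly what a Theorem-D-type binder must say to close `stub_c3` BY
NAME: the binder's conclusion with `X_ac` strict at the frame's prime. Given that shape at every X2c
Heegner datum, `stub_c3` follows ALONE — no D′ (`μ/λ`), no CTL-split, no published fact — by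
`R₀ ⊆ 𝓞_{ℂ_p}` (`R1.isBDPLFunctionInt_map`, `R1.imcEqIntAt_map`) and k5-c4's ideal rigidity across frames
(`X11b.R1.imcEqIntAt_iff_of_isBDPLFunctionInt`, `X2.nonsplitIMCEqOnTreeInt_of_someFrame`).

* `charIdeal_literature_eq` — the Literature `X_ac` IS the Summits one (`rfl`; companion of
  `AcSelmer.charIdeal_eq_literature`).
* `nonsplitIMCEqOnTreeInt_of_thmDShapeAt` — c3♭ from the Thm-D conclusion shape at `𝔭`.
* `splitIMCEqOnTreeInt_of_thmDShapeAt` — c3s♭ likewise (no sign enters).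
* `stub_c3_of_thmDShape` — the registered `stub_c3` signature VERBATIM from the two shapes.

What this is NOT: not a proof of Thm. D, of c3♭, or of either convention; not a use of the `_OPEN` binder.
Compared with seat g0's `stub_c3_of_fittingRevDivInt_of_splitControl_of_muLambdaInt` (p463269: one-sided
Fitting divisibility + CTL-split + D′♭ + PUB ×7), the EQUALITY shape needs nothing else. The premise also
exhibits the second gap between the binder and the stub: Keller–Yin's Thm. D assumes `D_K` odd and
`≠ −3`, while the stub quantifies over every imaginary quadratic `K` with `D_K < −4` (memo §5).

References: [KellerYin2024] Thm. D = Thm. 5.1.3, §5.1 (arXiv:2402.12781v2, PRE); [Castella2018] Def. 2.2,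
Thm. 3.1, Thm. 4.1 (arXiv:1704.06608 pp. 5, 9, 10); [CastellaHsieh2018] §3.3, Def. 3.5, Prop. 3.6
(arXiv:1505.08165 pp. 9–11); [CastellaGrossiLeeSkinner2022] §1.4, Thm. 2.1.1; [BurungaleCastellaKim2021]
§2, Conj. 1.4, Thm. 4.1; cell memos cgshw MEMO-10, bsd-eis-c3h MEMO-1.
-/

set_option autoImplicit false
set_option linter.dupNamespace false

noncomputable section

open scoped Classical MatrixGroups ModularForm

open CongruenceSubgroup WeierstrassCurve NumberField IsDedekindDomain Field PowerSeries
  Literature.NumberTheory.EllipticCurves Literature.NumberTheory.EllipticCurves.GreenbergSelmer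
  Literature.NumberTheory.EllipticCurves.ModularForms
  Literature.NumberTheory.EllipticCurves.Rank1Residual
  Literature.NumberTheory.EllipticCurves.Rank1Residual.Typed
  Literature.NumberTheory.GaloisRepresentations Literature.NumberTheory.GaloisCohomology
  Literature.NumberTheory.Automorphic
  Summit.BirchSwinnertonDyer.Rank1Residual.X11b.AcSelmer
  Summit.BirchSwinnertonDyer.Rank1Residual.X11b.Halves
  Summit.BirchSwinnertonDyer.Rank1Residual.X11b
  Summit.BirchSwinnertonDyer.Rank1Residual.X2

namespace Summit.BirchSwinnertonDyer.BirchSwinnertonDyer.Theorems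

/-! ### §0 The Literature `X_ac` is the Summits `X_ac` -/

/-- **The Literature `Ch_Λ(X_ac^Σ)` IS the Summits one** (`Literature.…Castella2018.AcSelmer.XAc.charIdeal`,
the re-homed construction on which the Keller–Yin / CGLS binders are stated, vs
`X11b.AcSelmer.XAc.charIdeal`, on which c3♭/c3s♭ are stated): both unfold to the same term (`rfl`).
Companion of `AcSelmer.charIdeal_eq_literature` (Theorems/ErratumRoadFiveOpenInputIMCFromErratumFact.lean),
restated here to keep this file's imports route-free. [cite: Castella2018, Def. 2.2 and Thm. 2.3 (arXiv:1704.06608 p. 5)] -/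
theorem charIdeal_literature_eq {K : Type} [Field K] [NumberField K] (W' : WeierstrassCurve K)
    (p : ℕ) [Fact p.Prime] (κ : ZpExtension K p) (𝔭 : HeightOneSpectrum (𝓞 K))
    (S : Set (HeightOneSpectrum (𝓞 K))) (γ : Field.absoluteGaloisGroup K) [Fact (κ.IsTopGenerator γ)] :
    Literature.NumberTheory.EllipticCurves.Castella2018.AcSelmer.XAc.charIdeal W' p κ 𝔭 S γ =
      Summit.BirchSwinnertonDyer.Rank1Residual.X11b.AcSelmer.XAc.charIdeal W' p κ 𝔭 S γ := by
  unfold Summit.BirchSwinnertonDyer.Rank1Residual.X11b.AcSelmer.XAc.charIdeal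
    Literature.NumberTheory.EllipticCurves.Castella2018.AcSelmer.XAc.charIdeal
  rfl

/-! ### §1 The Theorem-D conclusion shape at the frame's prime ⟹ c3♭ and c3s♭ -/

section Shapes

variable {W : WeierstrassCurve ℚ} [W.IsElliptic] [W.IsGloballyMinimal] {p : ℕ} [Fact p.Prime]

/-- **c3♭ from the Keller–Yin Theorem-D conclusion shape WITH `X_ac` STRICT AT THE FRAME'S PRIME.**
Premise (inline, hypothesis-shaped; the binders of `X2.NonsplitIMCEqOnTreeInt W p` up to the embedding
datum, then VERBATIM the conclusion of `KellerYin2024.thmD_imcMult_exists_isBDPLFunction_isTorsion_charIdeal_eq_OPEN`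
with its `vbar` replaced by the prime `𝔭` induced by `ι'`): at every X2 ∩ {non-split} Heegner datum there
are `Ω_K ≠ 0`, `Ω_p ∈ R₀ˣ`, `L ∈ R₀⟦T⟧` with `IsBDPLFunction ι' 𝔭 κ γ f Ω_K Ω_p L`, `X_ac^∅` (strict at
`𝔭`) `Λ`-torsion, and `Ch_Λ(X_ac^∅)·R₀⟦T⟧ = (L)` along every structure map `j : ℤ_p → R₀`. Conclusion:
c3♭ (`Ch_Λ(X_ac^∅)·𝓞_{ℂ_p}⟦T⟧ = (Q)` for EVERY ♭-frame `Q`). Proof: specialise `j` to `toUnr`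
(`coe_toUnr`), read `L` in `𝓞_{ℂ_p}⟦T⟧` (`R1.imcEqIntAt_map`, `R1.isBDPLFunctionInt_map`), and apply k5-c4's
frame rigidity (`X2.nonsplitIMCEqOnTreeInt_of_someFrame`). No `μ/λ` input, no control theorem, no
published fact. CONDITIONAL on the premise, which is NOT the tree's Thm-D binder (that one has `X_ac`
strict at `v̄`); nothing asserted. [claim: KellerYin2024, status: under-review]
[cite: KellerYin2024, Thm. D = Thm. 5.1.3 (arXiv:2402.12781v2 L306–L309, L1771–L1780)]
[cite: Castella2018, Thm. 3.1 (arXiv:1704.06608 p. 9)] -/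
theorem nonsplitIMCEqOnTreeInt_of_thmDShapeAt
    (hD : ∀ (N : ℕ) [NeZero N] (K : Type) [Field K] [NumberField K]
      (Dt : ModularParametrizationData W N) (H : HeegnerDatum N (NumberField.discr K)) (ιK : K →+* ℂ)
      (P : (W.baseChange K).toAffine.Point),
      CellC W p → ¬ W.HasSplitMultiplicativeReductionAtPrime p → W.conductorNorm ℤ = N →
      IsImaginaryQuadratic K → NumberField.discr K < -4 → SatisfiesHeegnerHypothesis N K →
      (W.quadraticTwist (NumberField.discr K : ℚ)).entireLFunction 1 ≠ 0 →
      WeierstrassCurve.Affine.Point.map ιK.toRatAlgHom P = heegnerPointComplex Dt H →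
      ¬ (p : ℤ) ∣ Dt.c → ¬ IsOfFinAddOrder P →
      ∀ (κ : ZpExtension K p), κ.IsAnticyclotomic →
        ∀ (γ : Field.absoluteGaloisGroup K) [Fact (κ.IsTopGenerator γ)]
          (𝔭 : HeightOneSpectrum (𝓞 K)), ((p : ℕ) : 𝓞 K) ∈ 𝔭.asIdeal →
          𝔭.asIdeal.ramificationIdx (𝓞 ℚ) = 1 → 𝔭.asIdeal.inertiaDeg (𝓞 ℚ) = 1 →
          ∀ (f : CuspForm (CongruenceSubgroup.Gamma0 N) 2), IsNewformOf W f →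
            ∀ (ι' : PadicAlgCl p ≃+* ℂ),
              (∀ (w : InfinitePlace K) (k : 𝓞 K),
                k ∈ 𝔭.asIdeal ↔ ‖ι'.symm (w.embedding (k : K))‖ < 1) →
              ∃ (ΩK : ℂ) (Ωp : (unrIntegers p)ˣ) (L : UnrSeries p),
                ΩK ≠ 0 ∧ IsBDPLFunction ι' 𝔭 κ γ f ΩK ((Ωp : unrIntegers p) : ℂ_[p]) L ∧
                Module.IsTorsion (IwasawaAlgebra p)
                  (Literature.NumberTheory.EllipticCurves.Castella2018.AcSelmer.XAc
                    (W.baseChange K) p κ 𝔭 ∅ γ) ∧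
                ∀ (j : ℤ_[p] →+* unrIntegers p),
                  (∀ x : ℤ_[p], ((j x : unrIntegers p) : ℂ_[p]) = algebraMap ℚ_[p] ℂ_[p] (x : ℚ_[p])) →
                  (Literature.NumberTheory.EllipticCurves.Castella2018.AcSelmer.XAc.charIdeal
                      (W.baseChange K) p κ 𝔭 ∅ γ).map (PowerSeries.map j) = Ideal.span {L}) :
    NonsplitIMCEqOnTreeInt W p := by
  refine nonsplitIMCEqOnTreeInt_of_someFrame (W := W) (p := p) ?_
  intro N _ K _ _ Dt H ιK P hc hns hN hK hd4 hHN hLt hP hcM hPinf κ hκ γ _ 𝔭 h𝔭 he hf f hfW ι' hι'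
  obtain ⟨ΩK, Ωp, L, hΩK, hL, -, hEq⟩ :=
    hD N K Dt H ιK P hc hns hN hK hd4 hHN hLt hP hcM hPinf κ hκ γ 𝔭 h𝔭 he hf f hfW ι' hι'
  have h3 : R1.IMCEqOnTreeAt W p κ 𝔭 γ L := by
    unfold R1.IMCEqOnTreeAt
    rw [← charIdeal_literature_eq]
    exact hEq (toUnr p) (coe_toUnr p)
  refine ⟨ΩK, ((Ωp : unrIntegers p) : ℂ_[p]), PowerSeries.map (R1.unrToCpInt p) L, hΩK, ?_,
    R1.isBDPLFunctionInt_map hL, R1.imcEqIntAt_map h3⟩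
  have h1 : ‖((Ωp : unrIntegers p) : ℂ_[p])‖ = 1 := norm_coe_units_unrIntegers p Ωp
  exact fun h0 ↦ by rw [h0, norm_zero] at h1; exact zero_ne_one h1

omit [W.IsElliptic] [W.IsGloballyMinimal] in
/-- **c3s♭ from the same Theorem-D conclusion shape at a SPLIT X2c datum** (the sign never enters:
Keller–Yin's Thm. D has no sign hypothesis). Premise: the binders of `X2.SplitIMCEqOnTreeInt W p` up to
the embedding datum, then the Thm-D conclusion with `X_ac` strict at `𝔭`. Proof: as for the non-split
conjunct, with the frame rigidity `X11b.R1.imcEqIntAt_iff_of_isBDPLFunctionInt` applied directly (odd `p`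
from `CellC`, `Ω_p ≠ 0` from `‖Ω_p‖ = 1`). CONDITIONAL on the premise; nothing asserted.
[claim: KellerYin2024, status: under-review]
[cite: KellerYin2024, Thm. D = Thm. 5.1.3 (arXiv:2402.12781v2 L306–L309, L1771–L1780), no sign hypothesis]
[cite: Castella2018, Thm. 3.1 (arXiv:1704.06608 p. 9)] -/
theorem splitIMCEqOnTreeInt_of_thmDShapeAt
    (hD : ∀ (N : ℕ) [NeZero N] (K : Type) [Field K] [NumberField K]
      (Dt : ModularParametrizationData W N) (H : HeegnerDatum N (NumberField.discr K)) (ιK : K →+* ℂ)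
      (P : (W.baseChange K).toAffine.Point),
      CellC W p → W.HasSplitMultiplicativeReductionAtPrime p → W.conductorNorm ℤ = N →
      IsImaginaryQuadratic K → NumberField.discr K < -4 → SatisfiesHeegnerHypothesis N K →
      (W.quadraticTwist (NumberField.discr K : ℚ)).entireLFunction 1 ≠ 0 →
      WeierstrassCurve.Affine.Point.map ιK.toRatAlgHom P = heegnerPointComplex Dt H →
      ¬ (p : ℤ) ∣ Dt.c → ¬ IsOfFinAddOrder P →
      ∀ (κ : ZpExtension K p), κ.IsAnticyclotomic →
        ∀ (γ : Field.absoluteGaloisGroup K) [Fact (κ.IsTopGenerator γ)]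
          (𝔭 : HeightOneSpectrum (𝓞 K)), ((p : ℕ) : 𝓞 K) ∈ 𝔭.asIdeal →
          𝔭.asIdeal.ramificationIdx (𝓞 ℚ) = 1 → 𝔭.asIdeal.inertiaDeg (𝓞 ℚ) = 1 →
          ∀ (f : CuspForm (CongruenceSubgroup.Gamma0 N) 2), IsNewformOf W f →
            ∀ (ι' : PadicAlgCl p ≃+* ℂ),
              (∀ (w : InfinitePlace K) (k : 𝓞 K),
                k ∈ 𝔭.asIdeal ↔ ‖ι'.symm (w.embedding (k : K))‖ < 1) →
              ∃ (ΩK : ℂ) (Ωp : (unrIntegers p)ˣ) (L : UnrSeries p),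
                ΩK ≠ 0 ∧ IsBDPLFunction ι' 𝔭 κ γ f ΩK ((Ωp : unrIntegers p) : ℂ_[p]) L ∧
                Module.IsTorsion (IwasawaAlgebra p)
                  (Literature.NumberTheory.EllipticCurves.Castella2018.AcSelmer.XAc
                    (W.baseChange K) p κ 𝔭 ∅ γ) ∧
                ∀ (j : ℤ_[p] →+* unrIntegers p),
                  (∀ x : ℤ_[p], ((j x : unrIntegers p) : ℂ_[p]) = algebraMap ℚ_[p] ℂ_[p] (x : ℚ_[p])) →
                  (Literature.NumberTheory.EllipticCurves.Castella2018.AcSelmer.XAc.charIdeal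
                      (W.baseChange K) p κ 𝔭 ∅ γ).map (PowerSeries.map j) = Ideal.span {L}) :
    SplitIMCEqOnTreeInt W p := by
  intro N _ K _ _ Dt H ιK P hc hs hN hK hd4 hHN hLt hP hcM hPinf κ hκ γ _ 𝔭 h𝔭 he hf f hfW ι' hι'
    ΩK' Ωp' Q hΩK' hΩp' hQ
  obtain ⟨ΩK, Ωp, L, hΩK, hL, -, hEq⟩ :=
    hD N K Dt H ιK P hc hs hN hK hd4 hHN hLt hP hcM hPinf κ hκ γ 𝔭 h𝔭 he hf f hfW ι' hι'
  have h3 : R1.IMCEqOnTreeAt W p κ 𝔭 γ L := by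
    unfold R1.IMCEqOnTreeAt
    rw [← charIdeal_literature_eq]
    exact hEq (toUnr p) (coe_toUnr p)
  have h1 : ‖((Ωp : unrIntegers p) : ℂ_[p])‖ = 1 := norm_coe_units_unrIntegers p Ωp
  have hΩp : ((Ωp : unrIntegers p) : ℂ_[p]) ≠ 0 :=
    fun h0 ↦ by rw [h0, norm_zero] at h1; exact zero_ne_one h1
  have hΩp0 : Ωp' ≠ 0 := fun h0 ↦ by rw [h0, norm_zero] at hΩp'; exact zero_ne_one hΩp'
  exact (R1.imcEqIntAt_iff_of_isBDPLFunctionInt (W := W) hc.2.1 hK hκ hΩK hΩK' hΩp hΩp0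
    (R1.isBDPLFunctionInt_map hL) hQ).mp (R1.imcEqIntAt_map h3)

end Shapes

/-! ### §2 `stub_c3` verbatim -/

/-- **`stub_c3` (line b1 v7, crux 4 `BSDpOnCellC`) FROM THE KELLER–YIN THEOREM-D CONCLUSION SHAPE WITH
`X_ac` STRICT AT THE FRAME'S PRIME, at every X2c Heegner datum of either sign — and NOTHING ELSE.**
Conclusion = the registered `stub_c3` signature VERBATIM. The two premises `hDn` / `hDs` are, binder for
binder, the stub's own data followed by the conclusion of
`KellerYin2024.thmD_imcMult_exists_isBDPLFunction_isTorsion_charIdeal_eq_OPEN` with `vbar ↦ 𝔭` (the prime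
induced by `ι'`). They are NOT supplied by that binder as typed (it puts the strict prime at `v̄`; the two
typings name complex-conjugate Selmer modules, `Ch` differing by `γ ↦ γ⁻¹` — seat memo c3h MEMO-1), nor by
print without deciding the dual-module convention (memo §4), and Keller–Yin's own hypotheses (`D_K` odd,
`≠ −3`) are absent from the stub's data (memo §5). CONDITIONAL-RESULT; nothing booked.
[claim: KellerYin2024, status: under-review]
[cite: KellerYin2024, Thm. D = Thm. 5.1.3 (arXiv:2402.12781v2 L306–L309, L1771–L1780)]
[cite: Castella2018, Def. 2.2 and Thm. 3.1 (arXiv:1704.06608 pp. 5, 9)]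
[cite: CastellaGrossiLeeSkinner2022, §1.4 and Thm. 2.1.1 (arXiv:2008.02571)] -/
theorem stub_c3_of_thmDShape
    (hDn : ∀ (W : WeierstrassCurve ℚ) [W.IsElliptic] [W.IsGloballyMinimal] (p : ℕ) [Fact p.Prime],
      CellC W p → ¬ W.HasSplitMultiplicativeReductionAtPrime p →
      ∀ (N : ℕ) [NeZero N] (K : Type) [Field K] [NumberField K]
        (Dt : ModularParametrizationData W N) (H : HeegnerDatum N (NumberField.discr K)) (ιK : K →+* ℂ)
        (P : (W.baseChange K).toAffine.Point),
        CellC W p → ¬ W.HasSplitMultiplicativeReductionAtPrime p → W.conductorNorm ℤ = N →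
        IsImaginaryQuadratic K → NumberField.discr K < -4 → SatisfiesHeegnerHypothesis N K →
        (W.quadraticTwist (NumberField.discr K : ℚ)).entireLFunction 1 ≠ 0 →
        WeierstrassCurve.Affine.Point.map ιK.toRatAlgHom P = heegnerPointComplex Dt H →
        ¬ (p : ℤ) ∣ Dt.c → ¬ IsOfFinAddOrder P →
        ∀ (κ : ZpExtension K p), κ.IsAnticyclotomic →
          ∀ (γ : Field.absoluteGaloisGroup K) [Fact (κ.IsTopGenerator γ)]
            (𝔭 : HeightOneSpectrum (𝓞 K)), ((p : ℕ) : 𝓞 K) ∈ 𝔭.asIdeal →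
            𝔭.asIdeal.ramificationIdx (𝓞 ℚ) = 1 → 𝔭.asIdeal.inertiaDeg (𝓞 ℚ) = 1 →
            ∀ (f : CuspForm (CongruenceSubgroup.Gamma0 N) 2), IsNewformOf W f →
              ∀ (ι' : PadicAlgCl p ≃+* ℂ),
                (∀ (w : InfinitePlace K) (k : 𝓞 K),
                  k ∈ 𝔭.asIdeal ↔ ‖ι'.symm (w.embedding (k : K))‖ < 1) →
                ∃ (ΩK : ℂ) (Ωp : (unrIntegers p)ˣ) (L : UnrSeries p),
                  ΩK ≠ 0 ∧ IsBDPLFunction ι' 𝔭 κ γ f ΩK ((Ωp : unrIntegers p) : ℂ_[p]) L ∧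
                  Module.IsTorsion (IwasawaAlgebra p)
                    (Literature.NumberTheory.EllipticCurves.Castella2018.AcSelmer.XAc
                      (W.baseChange K) p κ 𝔭 ∅ γ) ∧
                  ∀ (j : ℤ_[p] →+* unrIntegers p),
                    (∀ x : ℤ_[p], ((j x : unrIntegers p) : ℂ_[p]) = algebraMap ℚ_[p] ℂ_[p] (x : ℚ_[p])) →
                    (Literature.NumberTheory.EllipticCurves.Castella2018.AcSelmer.XAc.charIdeal
                        (W.baseChange K) p κ 𝔭 ∅ γ).map (PowerSeries.map j) = Ideal.span {L})
    (hDs : ∀ (W : WeierstrassCurve ℚ) [W.IsElliptic] [W.IsGloballyMinimal] (p : ℕ) [Fact p.Prime],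
      CellC W p → W.HasSplitMultiplicativeReductionAtPrime p →
      ∀ (N : ℕ) [NeZero N] (K : Type) [Field K] [NumberField K]
        (Dt : ModularParametrizationData W N) (H : HeegnerDatum N (NumberField.discr K)) (ιK : K →+* ℂ)
        (P : (W.baseChange K).toAffine.Point),
        CellC W p → W.HasSplitMultiplicativeReductionAtPrime p → W.conductorNorm ℤ = N →
        IsImaginaryQuadratic K → NumberField.discr K < -4 → SatisfiesHeegnerHypothesis N K →
        (W.quadraticTwist (NumberField.discr K : ℚ)).entireLFunction 1 ≠ 0 →
        WeierstrassCurve.Affine.Point.map ιK.toRatAlgHom P = heegnerPointComplex Dt H →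
        ¬ (p : ℤ) ∣ Dt.c → ¬ IsOfFinAddOrder P →
        ∀ (κ : ZpExtension K p), κ.IsAnticyclotomic →
          ∀ (γ : Field.absoluteGaloisGroup K) [Fact (κ.IsTopGenerator γ)]
            (𝔭 : HeightOneSpectrum (𝓞 K)), ((p : ℕ) : 𝓞 K) ∈ 𝔭.asIdeal →
            𝔭.asIdeal.ramificationIdx (𝓞 ℚ) = 1 → 𝔭.asIdeal.inertiaDeg (𝓞 ℚ) = 1 →
            ∀ (f : CuspForm (CongruenceSubgroup.Gamma0 N) 2), IsNewformOf W f →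
              ∀ (ι' : PadicAlgCl p ≃+* ℂ),
                (∀ (w : InfinitePlace K) (k : 𝓞 K),
                  k ∈ 𝔭.asIdeal ↔ ‖ι'.symm (w.embedding (k : K))‖ < 1) →
                ∃ (ΩK : ℂ) (Ωp : (unrIntegers p)ˣ) (L : UnrSeries p),
                  ΩK ≠ 0 ∧ IsBDPLFunction ι' 𝔭 κ γ f ΩK ((Ωp : unrIntegers p) : ℂ_[p]) L ∧
                  Module.IsTorsion (IwasawaAlgebra p)
                    (Literature.NumberTheory.EllipticCurves.Castella2018.AcSelmer.XAc
                      (W.baseChange K) p κ 𝔭 ∅ γ) ∧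
                  ∀ (j : ℤ_[p] →+* unrIntegers p),
                    (∀ x : ℤ_[p], ((j x : unrIntegers p) : ℂ_[p]) = algebraMap ℚ_[p] ℂ_[p] (x : ℚ_[p])) →
                    (Literature.NumberTheory.EllipticCurves.Castella2018.AcSelmer.XAc.charIdeal
                        (W.baseChange K) p κ 𝔭 ∅ γ).map (PowerSeries.map j) = Ideal.span {L}) :
    (∀ (W : WeierstrassCurve ℚ) [W.IsElliptic] [W.IsGloballyMinimal] (p : ℕ) [Fact p.Prime],
      CellC W p → ¬ W.HasSplitMultiplicativeReductionAtPrime p → NonsplitIMCEqOnTreeInt W p) ∧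
    (∀ (W : WeierstrassCurve ℚ) [W.IsElliptic] [W.IsGloballyMinimal] (p : ℕ) [Fact p.Prime],
      CellC W p → W.HasSplitMultiplicativeReductionAtPrime p → SplitIMCEqOnTreeInt W p) := by
  refine ⟨fun W _ _ p _ hc hns ↦ ?_, fun W _ _ p _ hc hs ↦ ?_⟩
  · exact nonsplitIMCEqOnTreeInt_of_thmDShapeAt (W := W) (p := p) fun N _ K _ _ Dt H ιK P hc' hns' ↦
      hDn W p hc hns N K Dt H ιK P hc' hns'
  · exact splitIMCEqOnTreeInt_of_thmDShapeAt (W := W) (p := p) fun N _ K _ _ Dt H ιK P hc' hs' ↦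
      hDs W p hc hs N K Dt H ιK P hc' hs'

end Summit.BirchSwinnertonDyer.BirchSwinnertonDyer.Theorems

end
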